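import Summits.ABC.IUTFork.Joshi.TestFundamentalEstimateBL
import Summits.ABC.IUTFork.Joshi.TestHarnessSeparation
import HarnessLib

/-!
# X-05 / R-J rows Y-31 · C-060: Joshi's Thm. 7.3.1 AS TYPED plus the `B_{L′}` volume dictionary is REALISABLE at a
# Cor. 3.12 setting EXACTLY when the typed Statement holds there (kernel iff; non-degenerate dictionary models)

Proof-only companion (abc-iut cell, block E → R-J «Joshi Y-discharge census», rung LADDER-ABC:A2.RESCUE.J; seat
abc-iut-E-t13 gen 7, R-J census typer #1, census file `HOME/plan/E/R-J/census-t13.tsv` rows Y-31 / Y-32 / C-060) of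
`Joshi/TestFundamentalEstimateBL.lean` (abc-iut-E-t12, p429522: test X-05 of the object O-024 =
`ATS3.AdelicThetaDatum.FundamentalEstimateBL`, K. Joshi, *Arithmetic Teichmüller Spaces III*, arXiv:2401.13508v4 (unrefereed;
bib `Joshi2024ATS3`), Thm. 7.3.1 p.55 l.1–30, typed — never asserted — in `Joshi/FundamentalEstimateBL.lean` p428437; the
dictionary `VolumeDictionaryBL = QVolumeReading ∧ ThetaVolumeReading` is OUR READING, NOT-IN-PRINT for §7).

WHAT p429522 RECORDED: SD ⟺ Statement under `ThetaFinite`; J (Thm. 7.3.1 as typed) ∧ dictionary ⟹ Statement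
(`statement_of_volumeDictionaryBL`); the dictionary FAILS at the pinned countermodel for every J-true datum; a DEGENERATE joint
model (trivial datum, all volumes `0`); «non-degenerate dict model: none yet».

WHAT THIS FILE ADDS (all kernel, 0 new `Prop`s, nothing of Joshi or of [IUTchIII] asserted):
1. `not_volumeDictionaryBL_of_not_statement` — at EVERY setting with `ThetaFinite ∧ ¬Statement` the dictionary fails for every
   J-true datum (p429522 had the pinned instance).
2. `qSum_nonpos_of_qVolumeReading` — the q-half of the dictionary alone forces `qSum P ≤ 0` (Joshi's q-bound is `≤ 1`).
3. `exists_volumeDictionaryBL_of_statement` — CONVERSELY, at EVERY setting with `Statement ∧ qSum P ≤ 0` there IS a Joshi-side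
   datum `D` (one place, `ℓ⋆ = 2`, `B = ℝ`, locus one constant tuple; interface-level, NOT a model of Joshi's rings) with
   `VolumeDictionaryBL D P ∧ D.FundamentalEstimateBL`; when `qSum P < 0` the datum has a bad place (`𝕍^{odd,ss} ≠ ∅`,
   `|q| < 1`), i.e. it is NON-DEGENERATE.
4. `exists_volumeDictionaryBL_iff` — hence, under `ThetaFinite`:
   `(∃ D, VolumeDictionaryBL D P ∧ D.FundamentalEstimateBL) ↔ (P.Statement ∧ qSum P ≤ 0)`, and under the printed side
   condition `AbsLogQPos` (`|log(q)| > 0`) simply `↔ P.Statement` (`exists_volumeDictionaryBL_iff_statement`).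
   READING FOR THE CENSUS (R9 token «RESTATES»): the pair (J, Y_vol^{BL}) carries, setting by setting, exactly the content of
   the typed Cor. 3.12 Statement — no more (item 1), no less (item 3); so row Y-31 has no per-datum prover load of its own:
   at genuine data it is decided iff the Statement is decided there.
5. The LOCAL STEP (row Y-32, `LocalThetaEstimateAt`): with the dictionary it forces the STRICT inequality `qSum P < thetaSum P`
   (`qSum_lt_thetaSum_of_localThetaEstimateAt`), and conversely `qSum P < thetaSum P ∧ qSum P < 0` is realised with the local
   step at `ρ = 1` (`exists_localThetaEstimateAt_of_lt`).
6. NON-DEGENERATE SEPARATION INSTANCE: at abc-iut-E-cx's separation model `expSetting p (2,4)` (Statement TRUE, S FALSE,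
   `Joshi/TestHarnessSeparation.lean`) a non-degenerate datum realises J ∧ Y_vol^{BL} ∧ local step — so
   J ∧ Y ∧ ThetaFinite ∧ Statement ∧ ¬S hold jointly in kernel (`realisable_and_not_S_expTwoFour`).
FRAMING (binding): locates / conditionally verifies; NO abc claim; no side taken on [IUTchIII] Cor. 3.12, on Joshi's claims or on
Mochizuki's report on them (or on Scholze–Stix / Dupuy–Hilado); typed ≠ proved; a realisability statement about a typed
CANDIDATE and an OUR-READING dictionary, nothing about Joshi's actual rings. bears_on: LADDER-ABC:A2.RESCUE.J
-/

noncomputable section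

open Set Finset

namespace Summit.ABC.IUTFork.Joshi.ATS3

open Thm311 Cor312 Cor312Vol Literature.IUT.LogThetaLattice Summit.ABC.IUTFork.Joshi

/-! ## 1. Necessary conditions: the dictionary forces `Statement` and `qSum ≤ 0` -/

section Necessary

variable {T : ThetaIndex} {S : Situation T} (P : Cor312.Setting S)

/-- Joshi's q-bound `∏_{w ∈ 𝕍^{odd,ss}} |q_w|^{ℓ⋆/2ℓ}` is at most `1` (each factor lies in `(0,1)`). [folklore] -/
theorem qBound_le_one (D : AdelicThetaDatum) : D.qBound ≤ 1 := by
  unfold AdelicThetaDatum.qBound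
  refine Finset.prod_le_one (fun w hw => (D.qFactor_pos hw).le) fun w hw => ?_
  have hlstar : (0 : ℝ) ≤ D.lstar := Nat.cast_nonneg _
  exact Real.rpow_le_one (D.qAbs_pos w hw).le (D.qAbs_lt_one w hw).le
    (div_nonneg hlstar (mul_nonneg zero_le_two D.ell_pos.le))

/-- The q-half of the dictionary alone forces `qSum P ≤ 0` (`log qBound ≤ 0`). [folklore] -/
theorem qSum_nonpos_of_qVolumeReading (D : AdelicThetaDatum) (h : QVolumeReading D P) : qSum P ≤ 0 :=
  h.trans (Real.log_nonpos D.qBound_pos.le (qBound_le_one D))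

/-- With `𝕍^{odd,ss} ≠ ∅` the q-bound is `< 1`. [folklore] -/
theorem qBound_lt_one (D : AdelicThetaDatum) (hne : D.Vss.Nonempty) : D.qBound < 1 := by
  classical
  obtain ⟨w₀, hw₀⟩ := hne
  have hlstar : (0 : ℝ) < D.lstar := by exact_mod_cast lt_of_lt_of_le (by norm_num) D.two_le_lstar
  have hexp : 0 < (D.lstar : ℝ) / (2 * D.ell) := div_pos hlstar (mul_pos two_pos D.ell_pos)
  have hf1 : ∀ w ∈ D.Vss, D.qAbs w ^ ((D.lstar : ℝ) / (2 * D.ell)) ≤ 1 := fun w hw =>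
    Real.rpow_le_one (D.qAbs_pos w hw).le (D.qAbs_lt_one w hw).le hexp.le
  have hw1 : D.qAbs w₀ ^ ((D.lstar : ℝ) / (2 * D.ell)) < 1 :=
    Real.rpow_lt_one (D.qAbs_pos w₀ hw₀).le (D.qAbs_lt_one w₀ hw₀) hexp
  unfold AdelicThetaDatum.qBound
  rw [← Finset.mul_prod_erase _ _ hw₀]
  have hrest : ∏ x ∈ D.Vss.erase w₀, D.qAbs x ^ ((D.lstar : ℝ) / (2 * D.ell)) ≤ 1 :=
    Finset.prod_le_one (fun w hw => (D.qFactor_pos (Finset.mem_of_mem_erase hw)).le)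
      fun w hw => hf1 w (Finset.mem_of_mem_erase hw)
  have h0 : 0 ≤ ∏ x ∈ D.Vss.erase w₀, D.qAbs x ^ ((D.lstar : ℝ) / (2 * D.ell)) :=
    Finset.prod_nonneg fun w hw => (D.qFactor_pos (Finset.mem_of_mem_erase hw)).le
  calc D.qAbs w₀ ^ ((D.lstar : ℝ) / (2 * D.ell)) * ∏ x ∈ D.Vss.erase w₀, D.qAbs x ^ ((D.lstar : ℝ) / (2 * D.ell))
      ≤ D.qAbs w₀ ^ ((D.lstar : ℝ) / (2 * D.ell)) * 1 := mul_le_mul_of_nonneg_left hrest (D.qFactor_pos hw₀).le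
    _ < 1 := by rw [mul_one]; exact hw1

/-- … so the q-half of the dictionary then forces `qSum P < 0`. [folklore] -/
theorem qSum_neg_of_qVolumeReading (D : AdelicThetaDatum) (hne : D.Vss.Nonempty) (h : QVolumeReading D P) :
    qSum P < 0 :=
  h.trans_lt (Real.log_neg D.qBound_pos (qBound_lt_one D hne))

/-- **At every `¬Statement` setting (with `ThetaFinite`) the dictionary fails for EVERY datum satisfying Joshi's inequality**
(generalises p429522's `not_volumeDictionaryBL_pinnedSetting`). [folklore] -/
theorem not_volumeDictionaryBL_of_not_statement (D : AdelicThetaDatum) (hJ : D.FundamentalEstimateBL)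
    (hfin : P.ThetaFinite) (hS : ¬ P.Statement) : ¬ VolumeDictionaryBL D P := fun h =>
  hS (statement_of_volumeDictionaryBL D P hJ h hfin)

/-- The necessary half packaged. [folklore] -/
theorem statement_and_qSum_nonpos_of_exists (hfin : P.ThetaFinite)
    (h : ∃ D : AdelicThetaDatum, VolumeDictionaryBL D P ∧ D.FundamentalEstimateBL) : P.Statement ∧ qSum P ≤ 0 := by
  obtain ⟨D, hY, hJ⟩ := h
  exact ⟨statement_of_volumeDictionaryBL D P hJ hY hfin, qSum_nonpos_of_qVolumeReading P D hY.1⟩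

/-- **The local step forces the STRICT inequality**: if some datum satisfies the dictionary and Joshi's local step at one
`ρ ∈ (0,1]` with `𝕍^{odd,ss} ≠ ∅`, then `qSum P < thetaSum P`. [folklore] -/
theorem qSum_lt_thetaSum_of_localThetaEstimateAt (D : AdelicThetaDatum) (hY : VolumeDictionaryBL D P) {ρ : ℝ}
    (hρ : ρ ∈ Set.Ioc (0 : ℝ) 1) (hJ : D.LocalThetaEstimateAt ρ) (hne : D.Vss.Nonempty) : qSum P < thetaSum P := by
  have h1 : D.qBound < D.adelicSize ρ (D.Xi D.std) := D.qBound_lt_adelicSize_std hJ hne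
  have h2 : ((D.adelicSize ρ (D.Xi D.std) : ℝ) : EReal) ≤ ((Real.exp (thetaSum P) : ℝ) : EReal) :=
    (D.adelicSize_le_size (D.Xi_mem_locus D.std) hρ).trans hY.2
  have h3 : D.qBound < Real.exp (thetaSum P) := h1.trans_le (EReal.coe_le_coe_iff.1 h2)
  have h4 : Real.log D.qBound < thetaSum P := by
    have := Real.log_lt_log D.qBound_pos h3
    rwa [Real.log_exp] at this
  exact hY.1.trans_lt h4

end Necessary

/-! ## 2. The realising data: one place, `ℓ⋆ = 2`, `B = ℝ`, locus `{(a, a)}`, `|q| = c` -/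

section LineDatum

/-- The one-place LINE DATUM with parameters `a` (the common coordinate of the single locus element) and `c ∈ (0,1)` (the
absolute value of the Tate parameter): `𝕍 = 𝕍^{odd,ss} = {∗}`, `ℓ⋆ = 2` (`ℓ = 5`), `B = ℝ`, `|·|_ρ = |·|` for every `ρ`. Interface-level
witness only (NOT a model of Joshi's rings), in the style of p429522's `toyDatum`. [folklore] -/
def lineDatum (a c : ℝ) (hc0 : 0 < c) (hc1 : c < 1) : AdelicThetaDatum where
  W := Unit
  Vss := Finset.univ
  lstar := 2
  two_le_lstar := le_rfl
  prime_ell := Nat.prime_five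
  B := fun _ => ℝ
  one := fun _ => 1
  nrm := fun _ _ x => |x|
  nrm_nonneg := fun _ _ x => abs_nonneg x
  nrm_one := fun _ _ => abs_one
  top := fun _ => inferInstance
  continuous_nrm := fun _ _ _ => continuous_abs
  Bplus := fun _ => {x | |x| ≤ 1}
  nrm_le_one_of_mem_Bplus := fun _ _ hx => hx
  Idx := Unit
  Xi := fun _ _ _ => a
  Xi_off := fun _ w hw => absurd (Finset.mem_univ w) hw
  std := ()
  qAbs := fun _ => c
  qAbs_pos := fun _ _ => hc0
  qAbs_lt_one := fun _ _ => hc1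

variable (a c : ℝ) (hc0 : 0 < c) (hc1 : c < 1)

/-- The line datum has a bad place. [folklore] -/
theorem lineDatum_Vss_nonempty : (lineDatum a c hc0 hc1).Vss.Nonempty :=
  ⟨(), show () ∈ (Finset.univ : Finset Unit) from Finset.mem_univ _⟩

/-- Its q-bound is `c^{1/5}` (`ℓ⋆/2ℓ = 2/10`). [folklore] -/
theorem lineDatum_qBound : (lineDatum a c hc0 hc1).qBound = c ^ ((1 : ℝ) / 5) := by
  unfold AdelicThetaDatum.qBound
  show (∏ _w ∈ (Finset.univ : Finset Unit), c ^ (((2 : ℕ) : ℝ) / (2 * ((2 * 2 + 1 : ℕ) : ℝ)))) = c ^ ((1 : ℝ) / 5)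
  rw [Finset.prod_const, Finset.card_univ, Fintype.card_unit, pow_one]
  norm_num

/-- Every locus element has size `|a|·|a|` at every `ρ`. [folklore] -/
theorem lineDatum_adelicSize (ρ : ℝ) (z : (lineDatum a c hc0 hc1).Idx) :
    (lineDatum a c hc0 hc1).adelicSize ρ ((lineDatum a c hc0 hc1).Xi z) = |a| * |a| := by
  rw [(lineDatum a c hc0 hc1).adelicSize_Xi_eq_prod]
  show (∏ _w ∈ (Finset.univ : Finset Unit), ∏ _j : Fin 2, |a|) = |a| * |a|
  rw [Finset.prod_const, Finset.card_univ, Fintype.card_unit, pow_one, Fin.prod_univ_two]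

/-- The local size of the distinguished element at the bad place is `|a|·|a|`. [folklore] -/
theorem lineDatum_localSize_std (ρ : ℝ) (w : (lineDatum a c hc0 hc1).W) :
    (lineDatum a c hc0 hc1).localSize w ρ ((lineDatum a c hc0 hc1).Xi (lineDatum a c hc0 hc1).std w) = |a| * |a| := by
  show (∏ _j : Fin 2, |a|) = |a| * |a|
  rw [Fin.prod_univ_two]

/-- The size of the locus is EXACTLY `|a|·|a|`. [folklore] -/
theorem lineDatum_size : (lineDatum a c hc0 hc1).size (lineDatum a c hc0 hc1).locus = ((|a| * |a| : ℝ) : EReal) := by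
  refine le_antisymm (iSup₂_le fun ρ _ => (lineDatum a c hc0 hc1).sizeAt_le_coe (C := |a| * |a|) ?_) ?_
  · rintro x ⟨z, rfl⟩
    rw [lineDatum_adelicSize]
  · have h := (lineDatum a c hc0 hc1).adelicSize_le_size ((lineDatum a c hc0 hc1).Xi_mem_locus ()) (ρ := 1)
      ⟨one_pos, le_rfl⟩
    rwa [lineDatum_adelicSize] at h

end LineDatum

/-! ## 3. Sufficiency: `Statement ∧ qSum ≤ 0` is realised -/

section Sufficient

variable {T : ThetaIndex} {S : Situation T} (P : Cor312.Setting S)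

/-- `Statement ⟹ qSum ≤ thetaSum` (p429522's `summedDomination_of_statement`, unfolded). [folklore] -/
theorem qSum_le_thetaSum_of_statement (hS : P.Statement) : qSum P ≤ thetaSum P :=
  summedDomination_of_statement P hS

/-- **The non-degenerate realisation.** If `qSum P < 0` and `qSum P ≤ thetaSum P` (e.g. `Statement`), the line datum with
`a = exp(thetaSum/2)`, `c = exp(5·qSum)` satisfies the dictionary (both halves WITH EQUALITY) and Joshi's Thm. 7.3.1 as typed.
[folklore] -/
theorem lineDatum_realises (hq : qSum P < 0) (hle : qSum P ≤ thetaSum P) :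
    VolumeDictionaryBL (lineDatum (Real.exp (thetaSum P / 2)) (Real.exp (5 * qSum P)) (Real.exp_pos _)
        (Real.exp_lt_one_iff.2 (by linarith))) P ∧
      (lineDatum (Real.exp (thetaSum P / 2)) (Real.exp (5 * qSum P)) (Real.exp_pos _)
        (Real.exp_lt_one_iff.2 (by linarith))).FundamentalEstimateBL := by
  set D := lineDatum (Real.exp (thetaSum P / 2)) (Real.exp (5 * qSum P)) (Real.exp_pos _)
    (Real.exp_lt_one_iff.2 (by linarith)) with hD
  have hqB : D.qBound = Real.exp (qSum P) := by
    rw [hD, lineDatum_qBound, ← Real.exp_mul]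
    congr 1
    ring
  have habs : |Real.exp (thetaSum P / 2)| * |Real.exp (thetaSum P / 2)| = Real.exp (thetaSum P) := by
    rw [abs_of_pos (Real.exp_pos _), ← Real.exp_add]
    congr 1
    ring
  have hsize : D.size D.locus = ((Real.exp (thetaSum P) : ℝ) : EReal) := by
    rw [hD, lineDatum_size, habs]
  refine ⟨⟨?_, ?_⟩, ?_⟩
  · show qSum P ≤ Real.log D.qBound
    rw [hqB, Real.log_exp]
  · show D.size D.locus ≤ ((Real.exp (thetaSum P) : ℝ) : EReal)
    rw [hsize]
  · show ((D.qBound : ℝ) : EReal) ≤ D.size D.locus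
    rw [hqB, hsize, EReal.coe_le_coe_iff]
    exact Real.exp_le_exp.2 hle

/-- … and, when moreover `qSum P < thetaSum P` STRICTLY, Joshi's LOCAL STEP at `ρ = 1` as well. [folklore] -/
theorem lineDatum_localThetaEstimateAt (hq : qSum P < 0) (hlt : qSum P < thetaSum P) :
    (lineDatum (Real.exp (thetaSum P / 2)) (Real.exp (5 * qSum P)) (Real.exp_pos _)
        (Real.exp_lt_one_iff.2 (by linarith))).LocalThetaEstimateAt 1 := by
  intro w _
  have hfac : (Real.exp (5 * qSum P)) ^ (((2 : ℕ) : ℝ) / (2 * ((2 * 2 + 1 : ℕ) : ℝ))) = Real.exp (qSum P) := by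
    rw [← Real.exp_mul]
    congr 1
    push_cast
    ring
  show (Real.exp (5 * qSum P)) ^ (((2 : ℕ) : ℝ) / (2 * ((2 * 2 + 1 : ℕ) : ℝ))) < _
  rw [hfac, lineDatum_localSize_std, abs_of_pos (Real.exp_pos _), ← Real.exp_add, Real.exp_lt_exp]
  linarith

/-- **Sufficiency**: `Statement ∧ qSum ≤ 0` is realised by some datum (non-degenerate when `qSum < 0`; the trivial datum of
p429522 in the boundary case `qSum = 0`). [folklore] -/
theorem exists_volumeDictionaryBL_of_statement (hS : P.Statement) (hq : qSum P ≤ 0) :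
    ∃ D : AdelicThetaDatum, VolumeDictionaryBL D P ∧ D.FundamentalEstimateBL := by
  have hle := qSum_le_thetaSum_of_statement P hS
  rcases hq.lt_or_eq with hlt | heq
  · exact ⟨_, lineDatum_realises P hlt hle⟩
  · refine ⟨trivialDatum, ⟨?_, ?_⟩, trivialDatum_fundamentalEstimateBL⟩
    · show qSum P ≤ Real.log trivialDatum.qBound
      rw [trivialDatum_qBound, Real.log_one, heq]
    · show trivialDatum.size trivialDatum.locus ≤ ((Real.exp (thetaSum P) : ℝ) : EReal)
      refine trivialDatum_size_le_one.trans ?_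
      have h0 : (0 : ℝ) ≤ thetaSum P := by rw [← heq]; exact hle
      exact_mod_cast Real.one_le_exp h0

/-- Non-degenerate form: with `qSum < 0` the realising datum can be taken with a bad place. [folklore] -/
theorem exists_volumeDictionaryBL_nondegenerate_of_statement (hS : P.Statement) (hq : qSum P < 0) :
    ∃ D : AdelicThetaDatum, D.Vss.Nonempty ∧ VolumeDictionaryBL D P ∧ D.FundamentalEstimateBL :=
  ⟨_, lineDatum_Vss_nonempty _ _ _ _, lineDatum_realises P hq (qSum_le_thetaSum_of_statement P hS)⟩

/-- **Local-step realisation** (row Y-32): `qSum < thetaSum` strictly and `qSum < 0` are realised with the dictionary AND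
Joshi's local step at `ρ = 1` (conversely the local step forces strictness, `qSum_lt_thetaSum_of_localThetaEstimateAt`). [folklore] -/
theorem exists_localThetaEstimateAt_of_lt (hlt : qSum P < thetaSum P) (hq : qSum P < 0) :
    ∃ D : AdelicThetaDatum, D.Vss.Nonempty ∧ VolumeDictionaryBL D P ∧ D.LocalThetaEstimateAt 1 :=
  ⟨_, lineDatum_Vss_nonempty _ _ _ _, (lineDatum_realises P hq hlt.le).1, lineDatum_localThetaEstimateAt P hq hlt⟩

end Sufficient

/-! ## 4. The iff (census token «RESTATES») -/

section Iff

variable {T : ThetaIndex} {S : Situation T} (P : Cor312.Setting S)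

/-- **Realisability of (Thm. 7.3.1 as typed ∧ the `B_{L′}` volume dictionary) at `P` ⟺ `Statement P ∧ qSum P ≤ 0`**, under
`ThetaFinite`. [folklore] -/
theorem exists_volumeDictionaryBL_iff (hfin : P.ThetaFinite) :
    (∃ D : AdelicThetaDatum, VolumeDictionaryBL D P ∧ D.FundamentalEstimateBL) ↔ (P.Statement ∧ qSum P ≤ 0) :=
  ⟨statement_and_qSum_nonpos_of_exists P hfin, fun h => exists_volumeDictionaryBL_of_statement P h.1 h.2⟩

/-- `AbsLogQPos` (`|log(q)| > 0`, [IUTchIII] Cor. 3.12's side condition as typed) is `qSum P < 0`. [folklore] -/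
theorem qSum_neg_of_absLogQPos (h : P.AbsLogQPos) : qSum P < 0 := by
  have hl : (0 : ℝ) < T.lstar := by exact_mod_cast lt_of_lt_of_le (by norm_num) T.two_le_lstar
  have h' : qSum P / T.lstar < 0 := h
  rcases div_neg_iff.1 h' with ⟨_, hneg⟩ | ⟨hlt, _⟩
  · exact absurd hneg (not_lt.2 hl.le)
  · exact hlt

/-- **Under `ThetaFinite ∧ AbsLogQPos`: realisable ⟺ Statement** — the pair (J, Y_vol^{BL}) RESTATES the typed Cor. 3.12
Statement setting by setting. [folklore] -/
theorem exists_volumeDictionaryBL_iff_statement (hfin : P.ThetaFinite) (hpos : P.AbsLogQPos) :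
    (∃ D : AdelicThetaDatum, VolumeDictionaryBL D P ∧ D.FundamentalEstimateBL) ↔ P.Statement := by
  rw [exists_volumeDictionaryBL_iff P hfin]
  exact ⟨fun h => h.1, fun h => ⟨h, (qSum_neg_of_absLogQPos P hpos).le⟩⟩

/-- Non-degenerate version under `AbsLogQPos`: realisable with a bad place ⟺ Statement. [folklore] -/
theorem exists_nondegenerate_iff_statement (hfin : P.ThetaFinite) (hpos : P.AbsLogQPos) :
    (∃ D : AdelicThetaDatum, D.Vss.Nonempty ∧ VolumeDictionaryBL D P ∧ D.FundamentalEstimateBL) ↔ P.Statement :=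
  ⟨fun ⟨D, _, hY, hJ⟩ => statement_of_volumeDictionaryBL D P hJ hY hfin,
    fun h => exists_volumeDictionaryBL_nondegenerate_of_statement P h (qSum_neg_of_absLogQPos P hpos)⟩

end Iff

/-! ## 5. The non-degenerate separation instance: E-cx's `expSetting p (2,4)` (Statement TRUE, S FALSE) -/

section Strict

variable {T : ThetaIndex} {S : Situation T} (P : Cor312.Setting S)

/-- A STRICT typed Statement (`−|log(q)| < −|log(Θ)|`, finite) gives `qSum < thetaSum`. [folklore] -/
theorem qSum_lt_thetaSum_of_strict (hfin : P.ThetaFinite)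
    (h : ((P.negLogQ : ℝ) : WithTop ℝ) < P.negLogTheta) : qSum P < thetaSum P := by
  have hl : (0 : ℝ) < T.lstar := by exact_mod_cast lt_of_lt_of_le (by norm_num) T.two_le_lstar
  unfold Setting.negLogTheta at h
  rw [if_pos hfin, WithTop.coe_lt_coe] at h
  unfold Setting.negLogQ processionNormalized at h
  unfold qSum thetaSum
  exact (div_lt_div_iff_of_pos_right hl).1 h

end Strict

section Separation

open Cor312.Checks Cor312.IdentifiedNonVacuity Literature.IUT.LogThetaLattice
open PinnedWitness NaiveWitness GluedMonoids.Naive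

variable (p : ℕ) [hp : Fact p.Prime]

/-- At `e = (2,4)` the typed Statement is STRICT: `−3·log p < −(5/2)·log p`. [folklore] -/
theorem statement_strict_expTwoFour :
    (((expSetting p expTwoFour).negLogQ : ℝ) : WithTop ℝ) < (expSetting p expTwoFour).negLogTheta := by
  rw [expSetting_negLogQ, expSetting_negLogTheta, WithTop.coe_lt_coe, esum_expTwoFour]
  have hL := log_p_pos p
  push_cast
  nlinarith

/-- **J ∧ Y_vol^{BL} ∧ local step, non-degenerately, at a Statement-true / S-false setting**: at abc-iut-E-cx's separation model
`expSetting p (2,4)` some datum with a bad place satisfies the dictionary, Thm. 7.3.1 as typed and its local step at `ρ = 1`,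
while `S = PilotKummerIndRelated` FAILS there (`not_pilotKummerIndRelated_expTwoFour`, p-file TestHarnessSeparation). Closes
X-05's «non-degenerate dict model: none yet» and separates (J ∧ Y_vol^{BL}) from S in kernel. [folklore] -/
theorem realisable_and_not_S_expTwoFour :
    (∃ D : AdelicThetaDatum, D.Vss.Nonempty ∧ VolumeDictionaryBL D (expSetting p expTwoFour) ∧
        D.FundamentalEstimateBL ∧ D.LocalThetaEstimateAt 1) ∧
      (expSetting p expTwoFour).Statement ∧
      ¬ PilotKummerIndRelated (naiveFull p).toLatticeSituation (expSetting p expTwoFour) (ballOfMonoid p)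
        fun v _ => qDatumExp p expTwoFour v := by
  have hS := statement_expTwoFour p
  have hq : qSum (expSetting p expTwoFour) < 0 := qSum_neg_of_absLogQPos _ (absLogQPos_expTwoFour p)
  have hlt : qSum (expSetting p expTwoFour) < thetaSum (expSetting p expTwoFour) :=
    qSum_lt_thetaSum_of_strict _ (expSetting_bridgeHyps p expTwoFour).finite (statement_strict_expTwoFour p)
  exact ⟨⟨_, lineDatum_Vss_nonempty _ _ _ _, (lineDatum_realises _ hq hlt.le).1, (lineDatum_realises _ hq hlt.le).2,
      lineDatum_localThetaEstimateAt _ hq hlt⟩, hS, not_pilotKummerIndRelated_expTwoFour p⟩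

end Separation

end Summit.ABC.IUTFork.Joshi.ATS3

end
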